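import Literature.NumberTheory.CubicFields.HasseUnramifiedResolvent
import Literature.NumberTheory.CubicFields.HasseCubicFieldOfClassField
import Literature.NumberTheory.CubicFields.ThreeTorsionMeanDecomposition
import Literature.NumberTheory.QuadraticFields.ThreeTorsionProofs
import HarnessLib

/-!
# Hasse's dictionary `#Cl(ℚ(√D))[3] = 2 · #{cubic fields of discriminant D} + 1` — proof

Topic `Literature/NumberTheory/CubicFields`.  This file PROVES the named fact
`Literature.NumberTheory.CubicFields.threeTorsion_eq_two_mul_cubicFieldCountOfDisc_add_one`
(`ThreeTorsionMeanDecomposition.lean`; Hasse 1930, Davenport–Heilbronn 1971 §6,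
Bhargava–Shankar–Tsimerman §8.5, Bhargava–Taniguchi–Thorne p. 3): for every fundamental
discriminant `D`,

  `quadFieldThreeTorsion D = 2 * cubicFieldCountOfDisc D + 1`.

No definition and no new named fact (D-0026); the discharge
`threeTorsion_eq_two_mul_cubicFieldCountOfDisc_add_one_holds` is the last theorem.

## Proof (BST §8.1, §8.5)

Let `k = ℚ(√D)` and let `𝓔(k)` be the set of intermediate fields of `k̄/k` Galois of degree `3` over
`k` and unramified at every finite prime.

1. `#Cl(𝓞_k)[3] = 2 · #{S ≤ Cl(𝓞_k) : [Cl : S] = 3} + 1` — finite abelian groups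
   (`ThreeTorsionProofs.quadFieldThreeTorsion_eq_two_mul_card_index_three_add_one`).
2. `#{S : [Cl : S] = 3} = #𝓔(k)` — class field theory (`HasseCubicClassFields.natCard_unramifiedCubic_eq`:
   existence and reciprocity for the class fields of the characters of `Cl(𝓞_k)`, the Artin map of
   an unramified cubic extension of odd degree, Bauer's theorem).
3. `#𝓔(k) = cubicFieldCountOfDisc D` (`natCard_unramifiedCubic_eq_cubicFieldCountOfDisc`), by the
   bijection `E ↦ [F_E]`, `F_E` a cubic subfield of `E` (which is an `S₃`-sextic over `ℚ`,
   `isGalois_rat_of_mem`), of discriminant `D` (`exists_cubicSubfield_of_mem`, Hasse's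
   `d(K₃) = d(K₂)` for unramified `K₆/K₂`):
   * injective: two members of `𝓔(k)` containing isomorphic cubic fields coincide
     (`eq_of_algHom_of_conj_mem`);
   * surjective (`exists_mem_algHom_of_discr_eq`): a cubic field `F` with `d_F = D` has its
     `S₃`-closure `L = F·k ∈ 𝓔(k)` — `L/k` is cyclic cubic (`exists_resolventClosure`) and
     UNRAMIFIED because `d_F = d_k` (`HasseUnramifiedResolvent`: the conductor in
     `d(K₃) = d(K₂) f²` is `1`) — and the cubic subfields of `L` are conjugate
     (`nonempty_algEquiv_of_algHom_of_finrank_eq_six`).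

## References

* H. Hasse, *Arithmetische Theorie der kubischen Zahlkörper auf klassenkörpertheoretischer
  Grundlage*, Math. Z. 31 (1930) 565–582. [Hasse1930]
* H. Davenport, H. Heilbronn, *On the density of discriminants of cubic fields. II*, Proc. Roy.
  Soc. London A 322 (1971) 405–420, §6. [DavenportHeilbronn1971]
* M. Bhargava, A. Shankar, J. Tsimerman, *On the Davenport–Heilbronn theorems and second order
  terms*, Invent. Math. 193 (2013) 439–499 = arXiv:1005.0672, §8.1, §8.5. [BhargavaShankarTsimerman2012]
* M. Bhargava, T. Taniguchi, F. Thorne, *Improved error estimates for the Davenport–Heilbronn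
  theorems*, Math. Ann. 389 (2024) = arXiv:2107.12819, p. 3. [BhargavaTaniguchiThorne2023]
-/

noncomputable section

open NumberField IsDedekindDomain Module IntermediateField
open scoped nonZeroDivisors

namespace Literature.NumberTheory.CubicFields

open Literature.NumberTheory.NumberFields Literature.NumberTheory.QuadraticFields
  Literature.NumberTheory.GaloisRepresentations

variable {k : Type} [Field k] [NumberField k]

/-! ### Surjectivity: the `S₃`-closure of a cubic field of discriminant `d_k` lies in `𝓔(k)` -/

/-- **A cubic field of discriminant `d_k` embeds into an unramified cyclic cubic extension of `k`
inside `k̄`** — its `S₃`-closure `L = F·k` (`exists_resolventClosure`), which is unramified over `k`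
because `d_F = d_k` (`natAbs_discr_eq_pow_three_of_discr_eq_discr`: `|d_L| = |d_k|³`, then
Neukirch III (2.6)–(2.10), `forall_isUnramifiedIn_iff_natAbs_discr_eq`).  This is BST §8.1:
"`K₆/K₂` is unramified" for a nowhere totally ramified cubic field.
[cite: BhargavaShankarTsimerman2012, §8.1] [cite: Hasse1930, Math. Z. 31, §1] -/
theorem exists_mem_algHom_of_discr_eq (hk : finrank ℚ k = 2) (F₀ : Type) [Field F₀]
    [NumberField F₀] (hF₀ : finrank ℚ F₀ = 3) (hd : discr F₀ = discr k) :
    ∃ E : IntermediateField k (AlgebraicClosure k),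
      E ∈ {E : IntermediateField k (AlgebraicClosure k) | IsGalois k E ∧ finrank k E = 3 ∧
        ∀ v : HeightOneSpectrum (𝓞 k), Algebra.IsUnramifiedIn (𝓞 E) v.asIdeal} ∧
      Nonempty (F₀ →ₐ[ℚ] E) := by
  obtain ⟨L, hLfd, hL3, hLab, hLgal, hL6, ⟨ι⟩, -⟩ :=
    exists_resolventClosure hk F₀ hF₀ (f := 1) one_ne_zero (by rw [hd, one_pow, mul_one])
  haveI := hLfd
  haveI := hLab
  haveI := hLgal
  haveI : FiniteDimensional ℚ L := Module.Finite.trans k L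
  haveI : CharZero L := charZero_of_injective_algebraMap (algebraMap k L).injective
  haveI : NumberField L := NumberField.mk
  -- the copies of `k` and `F₀` inside `L`
  set K' : IntermediateField ℚ L := (IsScalarTower.toAlgHom ℚ k L).fieldRange with hK'def
  have ek : k ≃ₐ[ℚ] K' := AlgEquiv.ofInjectiveField (IsScalarTower.toAlgHom ℚ k L)
  have hK'2 : finrank ℚ K' = 2 := by
    rw [← hk]
    exact (LinearEquiv.finrank_eq ek.toLinearEquiv).symm
  have hdK' : discr K' = discr k := (NumberField.discr_eq_discr_of_algEquiv k ek).symm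
  set F' : IntermediateField ℚ L := ι.fieldRange with hF'def
  have eF : F₀ ≃ₐ[ℚ] F' := AlgEquiv.ofInjectiveField ι
  have hF'3 : finrank ℚ F' = 3 := by
    rw [← hF₀]
    exact (LinearEquiv.finrank_eq eF.toLinearEquiv).symm
  have hdF' : discr F' = discr K' := by
    rw [← NumberField.discr_eq_discr_of_algEquiv F₀ eF, hd, hdK']
  -- Hasse: `|d_L| = |d_{K'}|³ = |d_k|³`, so `L/k` is unramified
  have hnum := natAbs_discr_eq_pow_three_of_discr_eq_discr hL6 K' F' hK'2 hF'3 hdF'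
  have hunr : ∀ v : HeightOneSpectrum (𝓞 k), Algebra.IsUnramifiedIn (𝓞 L) v.asIdeal :=
    (forall_isUnramifiedIn_iff_natAbs_discr_eq (K := k) (L := L)).mpr (by rw [hL3, hnum, hdK'])
  exact ⟨L, ⟨hLab.toIsGalois, hL3, hunr⟩, ⟨ι⟩⟩

/-! ### The bijection `𝓔(k) → {cubic fields of discriminant d_k}/≅` -/

/-- **`#𝓔(k) = #{cubic fields of discriminant d_k}/≅`** for a quadratic field `k` (Hasse 1930;
BST §8.1 and §8.5; Davenport–Heilbronn §6): `E ↦ [F_E]`, the class of a cubic subfield of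
discriminant `d_k` (`exists_cubicSubfield_of_mem`), is injective (`eq_of_algHom_of_conj_mem`) and
surjective (`exists_mem_algHom_of_discr_eq` with `nonempty_algEquiv_of_algHom_of_finrank_eq_six`).
[cite: BhargavaShankarTsimerman2012, §8.5 with §8.1] [cite: Hasse1930, Math. Z. 31] -/
theorem natCard_unramifiedCubic_eq_cubicFieldCountOfDisc [IsGalois ℚ k] (hk : finrank ℚ k = 2) :
    Nat.card {E : IntermediateField k (AlgebraicClosure k) | IsGalois k E ∧ finrank k E = 3 ∧
        ∀ v : HeightOneSpectrum (𝓞 k), Algebra.IsUnramifiedIn (𝓞 E) v.asIdeal} =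
      cubicFieldCountOfDisc (discr k) := by
  classical
  have hdata := fun E : {E : IntermediateField k (AlgebraicClosure k) | IsGalois k E ∧
      finrank k E = 3 ∧ ∀ v : HeightOneSpectrum (𝓞 k), Algebra.IsUnramifiedIn (𝓞 E) v.asIdeal} =>
    exists_cubicSubfield_of_mem hk E.2
  choose F₀ hF₀ hemb using hdata
  set Θ : {E : IntermediateField k (AlgebraicClosure k) | IsGalois k E ∧ finrank k E = 3 ∧
      ∀ v : HeightOneSpectrum (𝓞 k), Algebra.IsUnramifiedIn (𝓞 E) v.asIdeal} →
        CubicFieldClassesOfDisc (discr k) := fun E => Quotient.mk'' ⟨F₀ E, hF₀ E⟩ with hΘ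
  rw [cubicFieldCountOfDisc]
  refine Nat.card_eq_of_bijective Θ ⟨?_, ?_⟩
  · -- injective
    intro E₁ E₂ h
    have hr : Nonempty (((F₀ E₁ : FiniteSubfield) : Type) ≃ₐ[ℚ] ((F₀ E₂ : FiniteSubfield) : Type)) :=
      Quotient.exact' h
    obtain ⟨e⟩ := hr
    obtain ⟨ι₁⟩ := hemb E₁
    obtain ⟨ι₂⟩ := hemb E₂
    have hm₁ : IsGalois k (E₁ : IntermediateField k (AlgebraicClosure k)) ∧ finrank k E₁.1 = 3 ∧
        ∀ v : HeightOneSpectrum (𝓞 k), Algebra.IsUnramifiedIn (𝓞 E₁.1) v.asIdeal := E₁.2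
    have hm₂ : IsGalois k (E₂ : IntermediateField k (AlgebraicClosure k)) ∧ finrank k E₂.1 = 3 ∧
        ∀ v : HeightOneSpectrum (𝓞 k), Algebra.IsUnramifiedIn (𝓞 E₂.1) v.asIdeal := E₂.2
    haveI : FiniteDimensional k E₁.1 := Module.finite_of_finrank_eq_succ hm₁.2.1
    haveI : FiniteDimensional k E₂.1 := Module.finite_of_finrank_eq_succ hm₂.2.1
    exact Subtype.ext (eq_of_algHom_of_conj_mem hk hm₁.2.1 hm₂.2.1
      (fun g _ hx => conj_mem_of_mem hk E₁.2 g hx) (hF₀ E₁).1 ι₁ (ι₂.comp (e : _ →ₐ[ℚ] _)))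
  · -- surjective
    intro c
    obtain ⟨⟨F, hF⟩, rfl⟩ := Quotient.mk''_surjective c
    obtain ⟨E, hE, ⟨ι⟩⟩ := exists_mem_algHom_of_discr_eq hk F hF.1 hF.2
    refine ⟨⟨E, hE⟩, Quotient.sound' ?_⟩
    change Nonempty (((F₀ ⟨E, hE⟩ : FiniteSubfield) : Type) ≃ₐ[ℚ] ((F : FiniteSubfield) : Type))
    obtain ⟨hfd, hnf, hgalQ, h6⟩ := isGalois_rat_of_mem hk hE
    haveI := hfd
    haveI := hnf
    haveI := hgalQ
    obtain ⟨ι₀⟩ := hemb ⟨E, hE⟩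
    exact nonempty_algEquiv_of_algHom_of_finrank_eq_six E h6 (hF₀ ⟨E, hE⟩).1 ι₀ hF.1 ι

/-! ### The dictionary -/

/-- **Hasse's dictionary (Hasse 1930; Davenport–Heilbronn 1971 §6; BST §8.5; BTT p. 3):
`#Cl(ℚ(√D))[3] = 2 · #{cubic fields of discriminant D, up to iso} + 1`** for every fundamental
discriminant `D`: by `quadFieldThreeTorsion_eq_two_mul_card_index_three_add_one` (finite abelian
groups), `natCard_unramifiedCubic_eq` (class field theory) and
`natCard_unramifiedCubic_eq_cubicFieldCountOfDisc` (Hasse's correspondence), for the quadratic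
field of discriminant `D` (`Quadratic.exists_numberField_discr_eq`).
[cite: BhargavaShankarTsimerman2012, §8.5 with §8.1] [cite: BhargavaTaniguchiThorne2023, p. 3] -/
theorem quadFieldThreeTorsion_eq_two_mul_cubicFieldCountOfDisc_add_one {D : ℤ}
    (hD : (D % 4 = 1 ∧ Squarefree D ∧ D ≠ 1) ∨
      (4 ∣ D ∧ (D / 4 % 4 = 2 ∨ D / 4 % 4 = 3) ∧ Squarefree (D / 4))) :
    quadFieldThreeTorsion D = 2 * cubicFieldCountOfDisc D + 1 := by
  obtain ⟨K, _, _, h2, hdisc⟩ := Quadratic.exists_numberField_discr_eq hD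
  haveI : Algebra.IsQuadraticExtension ℚ K := { finrank_eq_two' := h2 }
  haveI : IsGalois ℚ K := inferInstance
  rw [quadFieldThreeTorsion_eq_two_mul_card_index_three_add_one D K h2 hdisc,
    ← natCard_unramifiedCubic_eq (k := K), natCard_unramifiedCubic_eq_cubicFieldCountOfDisc h2, hdisc]

/-- **Discharge of the named fact `threeTorsion_eq_two_mul_cubicFieldCountOfDisc_add_one`**
(`ThreeTorsionMeanDecomposition.lean`): the class-field-theoretic dictionary
`#Cl(ℚ(√D))[3] = 2 · #{cubic fields of discriminant D} + 1` on fundamental discriminants, now a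
theorem of the tree. [cite: BhargavaShankarTsimerman2012, §8.5 with §8.1] -/
theorem threeTorsion_eq_two_mul_cubicFieldCountOfDisc_add_one_holds :
    threeTorsion_eq_two_mul_cubicFieldCountOfDisc_add_one :=
  fun _ hD => quadFieldThreeTorsion_eq_two_mul_cubicFieldCountOfDisc_add_one hD

end Literature.NumberTheory.CubicFields

end
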